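import Literature.NumberTheory.Automorphic.UnitaryGroupTruncatedTraceClassPolynomialOfRows
import Literature.NumberTheory.Automorphic.UnitaryGroupTruncatedTraceClassDifferenceUnfolding
import Literature.NumberTheory.Automorphic.UnitaryGroupTruncatedKernelClassIntegrableHolds
import Literature.NumberTheory.Automorphic.UnitaryGroupKernelBorelClassHomogeneity
import Literature.NumberTheory.Automorphic.UnitaryGroupTruncatedTracePolynomialOfSiegel
import HarnessLib

/-!
# Every `J^T_𝔬(f)` is a polynomial in `log T` of degree `≤ 1` on `U(J₃)` of a CM field — item (3c) of the T1-qs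
# LAW 3 road (Arthur 1981, Prop. 2.3; Rogawski 1990, §2.3; Shokranian 1992, Thm. 5.7)

Topic `NumberTheory/Automorphic`; namespace `Literature.NumberTheory.Automorphic.UnitaryGroup`. THEOREMS ONLY over
accepted tree modules: no definition, no named fact, no instance, no notation, no `sorry`. The CLOSER of item (3c)
«per-class polynomial» of the T1-qs LAW 3 road (cell `pub/hodgecm-mathlib`, crux H413): ★ (3c-e)
`truncatedTraceClassPolynomial_of_parts` with its three class inputs discharged BY NAME —
`hhom` := ★ (C8) `kernelBorelClass_borel_mul_mul` (B-p04), `hparts` := ★ (L3-uℂ𝔬)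
`exists_truncatedTraceClass_sub_eq_parts'` (F0P4-p06), `hint` := ★ LAW 3a `truncatedKernelClassIntegrable_cm` (p05) —
and the torus Siegel set from ★ `exists_torusSiegel_coordinates` (H9a).

* `truncatedTraceClassPolynomial_of_truncatedKernelClassIntegrable` — generic quadratic `E/F` (`c² = 1 ≠ c`,
  `[E:F] = 2`, unimodularity, Iwasawa), from the per-class integrability of `k^T_𝔬` alone.
* **`truncatedTraceClassPolynomial_cm`** — at a CM extension `L/L⁺`, for EVERY class map `cl` with
  `IsConjInvariant cl`, `IsUnipotentInvariantOnBorel cl` and every class `i`, NO further hypothesis: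
  `∃ p, deg p ≤ 1, J^T_𝔬(f) = p(log T)` for all large `T`.

## References

* J. Arthur, *The trace formula in invariant form*, Ann. of Math. 114 (1981), Prop. 2.3
  [Arthur1981TraceFormulaInvariantForm].
* J. D. Rogawski, *Automorphic Representations of Unitary Groups in Three Variables*, Annals of Mathematics
  Studies 123 (1990), §2.3 (p. 14) [Rogawski1990].
* S. Shokranian, *The Selberg–Arthur Trace Formula*, LNM 1503 (1992), Thm. (5.7), Rem. (5.8) [Shokranian1992].
-/

set_option autoImplicit false

noncomputable section

open MeasureTheory Measure NumberField IsDedekindDomain Set Polynomial Literature.MeasureTheory.Group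
open scoped NNReal ENNReal

namespace Literature.NumberTheory.Automorphic

namespace UnitaryGroup

variable {F E : Type} [Field F] [NumberField F] [Field E] [NumberField E] [Algebra F E]
  {c : E ≃ₐ[F] E} {ι : Type*}

/-- **`J^T_𝔬(f)` is affine in `log T` for a quadratic `E/F`, from the per-class integrability of `k^T_𝔬`**
(`c² = 1 ≠ c`, `[E:F] = 2`, unimodularity of `U(J₃)(𝔸_F)`, the adelic Iwasawa decomposition): ★ (3c-e) with
`hhom`, `hparts` and the torus Siegel set discharged by ★ (C8), ★ (L3-uℂ𝔬), ★ H9a.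
[cite: Arthur1981TraceFormulaInvariantForm, Prop. 2.3] [cite: Rogawski1990, §2.3 (p. 14)] -/
theorem truncatedTraceClassPolynomial_of_truncatedKernelClassIntegrable (hc : c * c = 1) (hc1 : c ≠ 1)
    (h2 : Module.finrank F E = 2)
    (hunimod : ∀ [MeasurableSpace (quasiSplit F E c 3).Adelic] [BorelSpace (quasiSplit F E c 3).Adelic]
      (νG : Measure (quasiSplit F E c 3).Adelic), νG.IsHaarMeasure → νG.IsMulRightInvariant)
    (hBK : ∀ g : (quasiSplit F E c 3).Adelic, ∃ b ∈ borelAdelic F E c 3, ∃ k : (quasiSplit F E c 3).Adelic,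
      adelicVal F E c 3 ((StdForm.antidiagonal 3).over E) k ∈ standardMaximalCompactGL 3 E ∧ g = b * k)
    {cl : (quasiSplit F E c 3).arithmeticSubgroup → ι} (hcl : IsConjInvariant cl)
    (hclN : IsUnipotentInvariantOnBorel F E c 3 cl) (i : ι)
    (hint : ∀ [MeasurableSpace (adelicUnipotent F E c 3)] [BorelSpace (adelicUnipotent F E c 3)]
      (ν : Measure (adelicUnipotent F E c 3)) [ν.IsHaarMeasure] (𝓕 : Set (adelicUnipotent F E c 3)),
      IsFundamentalDomain (rationalUnipotent F E c 3) 𝓕 ν →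
      ∀ (μ : Measure (quasiSplit F E c 3).automorphicQuotient) [(quasiSplit F E c 3).IsAutomorphicMeasure μ]
        (f : (quasiSplit F E c 3).Adelic → ℂ), IsQuasiSplitTest F E c 3 f →
      ∃ T₀ : ℝ≥0, ∀ T : ℝ≥0, T₀ < T →
        Integrable ((quasiSplit F E c 3).quotFun (truncatedKernelClass ν 𝓕 T cl i f)) μ) :
    ∀ [MeasurableSpace (adelicUnipotent F E c 3)] [BorelSpace (adelicUnipotent F E c 3)]
      (ν : Measure (adelicUnipotent F E c 3)) [ν.IsHaarMeasure] (𝓕 : Set (adelicUnipotent F E c 3)),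
      IsFundamentalDomain (rationalUnipotent F E c 3) 𝓕 ν →
      ∀ (μ : Measure (quasiSplit F E c 3).automorphicQuotient) [(quasiSplit F E c 3).IsAutomorphicMeasure μ]
        (f : (quasiSplit F E c 3).Adelic → ℂ), IsQuasiSplitTest F E c 3 f →
      ∃ p : ℂ[X], p.natDegree ≤ 1 ∧ ∃ T₀ : ℝ≥0, ∀ T : ℝ≥0, T₀ < T →
        truncatedTraceClass μ ν 𝓕 T cl i f = p.eval ((Real.log (T : ℝ) : ℝ) : ℂ) :=
  truncatedTraceClassPolynomial_of_parts hc hc1 hunimod hBK cl i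
    (fun ν _ _ h𝓕 _ hfc hf b x y => kernelBorelClass_borel_mul_mul hc hc1 ν h𝓕 hclN hfc hf b x y i)
    (fun ν _ 𝓕 h𝓕 μ _ νG _ _ f hfc _ β hβ =>
      exists_truncatedTraceClass_sub_eq_parts' hcl hclN i ν 𝓕 h𝓕 μ νG f hfc β hβ)
    hint (exists_torusSiegel_coordinates h2 hc1)

/-- **EVERY `J^T_𝔬(f)` IS A POLYNOMIAL IN `log T` OF DEGREE `≤ 1` on `U(J₃)` of a CM field** — for every class map
`cl : G(F) → ι` whose fibres are unions of conjugacy classes (`IsConjInvariant`) and saturated under `N(F)` inside `B(F)`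
(`IsUnipotentInvariantOnBorel`), and every class `i`: for every Haar measure `ν` of `N(𝔸)`, fundamental domain `𝓕`,
automorphic measure `μ` and quasi-split test function `f` there is `p ∈ ℂ[X]`, `deg p ≤ 1`, with `J^T_𝔬(f) = p(log T)`
for all large `T` (Arthur (1981), Prop. 2.3; Rogawski (1990), §2.3). NO further hypothesis: ★ LAW 3a
`truncatedKernelClassIntegrable_cm`, ★ `forall_isHaarMeasure_isMulRightInvariant_quasiSplit_cm_three`, ★
`exists_mem_borelAdelic_mul_mem_standardMaximalCompactGL_cm_three`. [cite: Arthur1981TraceFormulaInvariantForm, Prop. 2.3]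
[cite: Rogawski1990, §2.3 (p. 14)] [cite: Shokranian1992, Thm. (5.7) and Rem. (5.8)] -/
theorem truncatedTraceClassPolynomial_cm (L : Type) [Field L] [NumberField L] [IsCMField L]
    {cl : (quasiSplit (↥(maximalRealSubfield L)) L (IsCMField.complexConj L) 3).arithmeticSubgroup → ι}
    (hcl : IsConjInvariant cl)
    (hclN : IsUnipotentInvariantOnBorel (↥(maximalRealSubfield L)) L (IsCMField.complexConj L) 3 cl) (i : ι) :
    ∀ [MeasurableSpace (adelicUnipotent (↥(maximalRealSubfield L)) L (IsCMField.complexConj L) 3)]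
      [BorelSpace (adelicUnipotent (↥(maximalRealSubfield L)) L (IsCMField.complexConj L) 3)]
      (ν : Measure (adelicUnipotent (↥(maximalRealSubfield L)) L (IsCMField.complexConj L) 3)) [ν.IsHaarMeasure]
      (𝓕 : Set (adelicUnipotent (↥(maximalRealSubfield L)) L (IsCMField.complexConj L) 3)),
      IsFundamentalDomain (rationalUnipotent (↥(maximalRealSubfield L)) L (IsCMField.complexConj L) 3) 𝓕 ν →
        ∀ (μ : Measure (quasiSplit (↥(maximalRealSubfield L)) L (IsCMField.complexConj L) 3).automorphicQuotient)
          [(quasiSplit (↥(maximalRealSubfield L)) L (IsCMField.complexConj L) 3).IsAutomorphicMeasure μ]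
          (f : (quasiSplit (↥(maximalRealSubfield L)) L (IsCMField.complexConj L) 3).Adelic → ℂ),
          IsQuasiSplitTest (↥(maximalRealSubfield L)) L (IsCMField.complexConj L) 3 f →
          ∃ p : ℂ[X], p.natDegree ≤ 1 ∧ ∃ T₀ : ℝ≥0, ∀ T : ℝ≥0, T₀ < T →
            truncatedTraceClass μ ν 𝓕 T cl i f = p.eval ((Real.log (T : ℝ) : ℝ) : ℂ) :=
  truncatedTraceClassPolynomial_of_truncatedKernelClassIntegrable (complexConj_mul_complexConj L)
    (IsCMField.complexConj_ne_one L) (Algebra.IsQuadraticExtension.finrank_eq_two (↥(maximalRealSubfield L)) L)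
    (forall_isHaarMeasure_isMulRightInvariant_quasiSplit_cm_three L)
    (exists_mem_borelAdelic_mul_mem_standardMaximalCompactGL_cm_three L) hcl hclN i
    (fun ν _ 𝓕 h𝓕 μ _ f hf => truncatedKernelClassIntegrable_cm L hcl hclN ν 𝓕 h𝓕 μ f hf i)

end UnitaryGroup

end Literature.NumberTheory.Automorphic
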